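import Literature.Geometry.Riemannian.HeatKernelBarrierSubsolution
import HarnessLib

/-!
# Barrier sub-solutions of the heat equation of a smooth family of metrics are dominated by its
# heat kernel measures (no Ricci flow)

`HeatKernelBarrierSubsolution.lean` proves, after R. Bamler (*Entropy and heat kernel bounds on a
Ricci flow background*, arXiv:2008.07093, §2.3 and §9), that a continuous function `w` on
`M × [s₁, s₂]` with `□w ≤ c` in the directional barrier sense satisfies
`∫ w(·,s₂) dν_{x,t;s₂} ≤ ∫ w(·,s₁) dν_{x,t;s₁} + c (s₂ − s₁)` for the heat kernel measures
`ν_{x,t;s}` of the family (`integral_heatKernelMeasure_le_of_directionalBarrier`). That statement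
is written for a family CARRYING A RICCI FLOW, but its proof — smooth approximation of `w(·, s₁)`,
the forward heat solution, the comparison principle `directional_barrier_maximum_principle`, and
`∫ U(s₂) dν_{x,t;s₂} = ∫ U(s₁) dν_{x,t;s₁}` — uses only that `h` is a `C^∞` family of Riemannian
metrics on a closed manifold. This file records the statement in that generality
(`integral_heatKernelMeasure_le_of_directionalBarrier_family`), so that it applies to the STATIC
family `r ↦ g` of a fixed Riemannian metric (`isContMDiffFamilyOn_const`): this is the form in
which "`Δ u ≥ -c` in the barrier (viscosity) sense ⟹ `t ↦ (P_t u)(x) + ct` is nondecreasing" is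
used to smooth barrier sub/supersolutions by the heat flow — in particular `cos d_p`, which
satisfies `Δ cos d_p ≥ -m cos d_p` in the viscosity sense under `Ric ≥ m - 1`
(`neg_mul_cos_edist_le_laplaceBeltrami`), the starting point of the approximation step in
Colding's proof of the volume sphere theorem (`Colding1996_volume_ghClose`; Colding 1997, sketch
of the proof of Thm. 1.1).

Everything is proved (the proof is that of `integral_heatKernelMeasure_le_of_directionalBarrier`,
verbatim); no definitions, no named facts (D-0026).

## References

* R. H. Bamler, *Entropy and heat kernel bounds on a Ricci flow background*, arXiv:2008.07093
  (2020), §2.3 and §9 (proof of Prop. 9.5). [Bamler2020Entropy]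
* T. H. Colding, *Aspects of Ricci curvature* (1997), §1. [Colding1997Aspects]
-/

noncomputable section

open Set Filter Function MeasureTheory Measure
open scoped Manifold ContDiff Topology ENNReal NNReal

namespace Literature.Geometry.Riemannian

open Lorentzian Lorentzian.PseudoRiemannianMetric

/-- **Barrier sub-solutions of the heat equation of a smooth family are dominated by its heat
kernel measures** (Bamler 2020a, §2.3 and §9; the tree's
`integral_heatKernelMeasure_le_of_directionalBarrier` without the Ricci flow hypothesis, which its
proof does not use). Let `h` be a `C^∞` family of Riemannian metrics on a closed connected
manifold, `x ∈ M`, `s₁ < s₂ < t`, and `w : M × [s₁, s₂] → ℝ` continuous with `□w ≤ c` in the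
directional barrier sense: at every `(y, r)`, `r ∈ (s₁, s₂]`, for every `η > 0`, an
`h(r)`-orthonormal frame `(eᵢ)` at `y`, one-variable lower barriers `Bᵢ(σ) ≤ w(exp_y(σ eᵢ), r)`
near `σ = 0`, touching, with second derivatives `bᵢ` at `0`, and a lower left time barrier
`Bᵗ ≤ w(y, ·)` touching at `r` with left derivative `p`, such that `p − Σᵢ bᵢ ≤ c + η`. Then
  `∫ w(·,s₂) dν_{x,t;s₂} ≤ ∫ w(·,s₁) dν_{x,t;s₁} + c (s₂ − s₁)`.
[cite: Bamler2020Entropy, §2.3 and §9, proof of Prop. 9.5] -/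
theorem integral_heatKernelMeasure_le_of_directionalBarrier_family {m : ℕ} {H : Type*}
    [TopologicalSpace H] {I : ModelWithCorners ℝ (EuclideanSpace ℝ (Fin m)) H} [I.Boundaryless]
    {M : Type*} [TopologicalSpace M] [ChartedSpace H M] [IsManifold I ∞ M]
    [T2Space M] [CompactSpace M] [SecondCountableTopology M] [MeasurableSpace M] [BorelSpace M]
    [ConnectedSpace M]
    {h : ℝ → PseudoRiemannianMetric I ∞ (EuclideanSpace ℝ (Fin m)) (TangentSpace I : M → Type _)}
    [∀ r, (h r).HasLeviCivita]
    (hh : IsContMDiffFamilyOn ∞ h univ) (hR : ∀ r, (h r).IsRiemannian) {t : ℝ}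
    (x : M) {s₁ s₂ : ℝ} (h12 : s₁ < s₂) (hs₂t : s₂ < t) {w : M → ℝ → ℝ}
    (hwc : ContinuousOn (fun p : M × ℝ ↦ w p.1 p.2) (univ ×ˢ Icc s₁ s₂)) {c : ℝ}
    (hbar : ∀ y, ∀ r ∈ Ioc s₁ s₂, ∀ η > 0,
      ∃ (e : Fin (Module.finrank ℝ (EuclideanSpace ℝ (Fin m))) → TangentSpace I y)
        (B B' : Fin (Module.finrank ℝ (EuclideanSpace ℝ (Fin m))) → ℝ → ℝ)
        (b : Fin (Module.finrank ℝ (EuclideanSpace ℝ (Fin m))) → ℝ) (Bt : ℝ → ℝ) (p : ℝ),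
        (∀ i j, (h r).val y (e i) (e j) = if i = j then 1 else 0) ∧
        (∀ i, (∀ᶠ σ in 𝓝 (0 : ℝ), HasDerivAt (B i) (B' i σ) σ) ∧ HasDerivAt (B' i) (b i) 0 ∧
          B i 0 = w y r ∧
          ∀ᶠ σ in 𝓝 (0 : ℝ), B i σ ≤ w (expMap (h r).leviCivita y (σ • e i)) r) ∧
        (HasDerivWithinAt Bt p (Iic r) r ∧ Bt r = w y r ∧ ∀ᶠ r' in 𝓝[<] r, Bt r' ≤ w y r') ∧
        p - ∑ i, b i ≤ c + η) :
    ∫ y, w y s₂ ∂(heatKernelMeasure hh hR t x s₂) ≤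
      ∫ y, w y s₁ ∂(heatKernelMeasure hh hR t x s₁) + c * (s₂ - s₁) := by
  have h2 : (2 : ℕ∞ω) ≤ ((⊤ : ℕ∞) : ℕ∞ω) := WithTop.coe_le_coe.mpr le_top
  -- slices of `w` are continuous, hence integrable against the probability measures `ν`
  have hws : ∀ r ∈ Icc s₁ s₂, Continuous fun y ↦ w y r := fun r hr ↦
    hwc.comp_continuous (continuous_id.prodMk continuous_const) fun y ↦ ⟨mem_univ _, hr⟩
  have hiw₁ : Integrable (fun y ↦ w y s₁) (heatKernelMeasure hh hR t x s₁) :=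
    (hws s₁ (left_mem_Icc.2 h12.le)).integrable_of_hasCompactSupport
      (HasCompactSupport.of_compactSpace _)
  have hiw₂ : Integrable (fun y ↦ w y s₂) (heatKernelMeasure hh hR t x s₂) :=
    (hws s₂ (right_mem_Icc.2 h12.le)).integrable_of_hasCompactSupport
      (HasCompactSupport.of_compactSpace _)
  refine le_of_forall_pos_le_add fun δ hδ ↦ ?_
  -- a smooth `φ` with `w(·, s₁) ≤ φ ≤ w(·, s₁) + δ`
  obtain ⟨ψ, hψ, hψδ⟩ := exists_contMDiff_abs_sub_lt I (hws s₁ (left_mem_Icc.2 h12.le))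
    (half_pos hδ)
  set φ : M → ℝ := fun y ↦ ψ y + δ / 2 with hφdef
  have hφ : ContMDiff I 𝓘(ℝ, ℝ) ∞ φ := hψ.add contMDiff_const
  have hφ1 : ∀ y, w y s₁ ≤ φ y := fun y ↦ by
    have := (abs_lt.1 (hψδ y)).1
    simp only [hφdef]
    linarith
  have hφ2 : ∀ y, φ y ≤ w y s₁ + δ := fun y ↦ by
    have := (abs_lt.1 (hψδ y)).2
    simp only [hφdef]
    linarith
  -- the forward heat solution `U` on `[s₁, t]` with `U(s₁) = φ`
  obtain ⟨U, hU, hU0, -⟩ := exists_isHeatSolutionOn_heatValue hh hR (h12.trans hs₂t) hφ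
  have hIcc : ∀ r ∈ Ioc s₁ s₂, r ∈ Icc s₁ t := fun r hr ↦ ⟨hr.1.le, hr.2.trans hs₂t.le⟩
  -- the comparison principle on `M × [s₁, s₂]`: `w ≤ U + c (r − s₁)`
  have hcomp : ∀ y, ∀ r ∈ Icc s₁ s₂, w y r ≤ U r y + c * (r - s₁) := by
    have hsub : (univ : Set M) ×ˢ Icc s₁ s₂ ⊆ (univ : Set M) ×ˢ Icc s₁ t :=
      prod_mono le_rfl (Icc_subset_Icc le_rfl hs₂t.le)
    refine directional_barrier_maximum_principle (ψ := w) (U := fun y r ↦ U r y) hR hwc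
      (hU.1.continuousOn.mono hsub) (fun r hr ↦ (hU.contMDiff_slice (hIcc r hr)).of_le h2)
      (fun y r hr ↦ (hU.2 r (hIcc r hr) y).hasDerivAt (Icc_mem_nhds hr.1 (hr.2.trans_lt hs₂t)))
      hbar fun y ↦ ?_
    show w y s₁ ≤ U s₁ y
    rw [hU0]
    exact hφ1 y
  -- integrate at `r = s₂` against `ν_{x,t;s₂}`
  have hiU₂ : Integrable (U s₂) (heatKernelMeasure hh hR t x s₂) :=
    (hU.contMDiff_slice ⟨h12.le, hs₂t.le⟩).continuous.integrable_of_hasCompactSupport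
      (HasCompactSupport.of_compactSpace _)
  have hiφ : Integrable φ (heatKernelMeasure hh hR t x s₁) :=
    hφ.continuous.integrable_of_hasCompactSupport (HasCompactSupport.of_compactSpace _)
  have step1 : ∫ y, w y s₂ ∂(heatKernelMeasure hh hR t x s₂) ≤
      ∫ y, U s₂ y ∂(heatKernelMeasure hh hR t x s₂) + c * (s₂ - s₁) := by
    calc ∫ y, w y s₂ ∂(heatKernelMeasure hh hR t x s₂)
        ≤ ∫ y, (U s₂ y + c * (s₂ - s₁)) ∂(heatKernelMeasure hh hR t x s₂) :=
          integral_mono hiw₂ (hiU₂.add (integrable_const _)) fun y ↦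
            hcomp y s₂ (right_mem_Icc.2 h12.le)
      _ = ∫ y, U s₂ y ∂(heatKernelMeasure hh hR t x s₂) + c * (s₂ - s₁) := by
          rw [integral_add hiU₂ (integrable_const _), integral_const, probReal_univ, one_smul]
  -- `∫ U(s₂) dν_{x,t;s₂} = ∫ φ dν_{x,t;s₁}`
  have step2 : ∫ y, U s₂ y ∂(heatKernelMeasure hh hR t x s₂) =
      ∫ y, φ y ∂(heatKernelMeasure hh hR t x s₁) := by
    rw [hU.integral_heatKernelMeasure_eq hh hR h12.le hs₂t x, hU0]
  -- `∫ φ dν_{x,t;s₁} ≤ ∫ w(·,s₁) dν_{x,t;s₁} + δ`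
  have step3 : ∫ y, φ y ∂(heatKernelMeasure hh hR t x s₁) ≤
      ∫ y, w y s₁ ∂(heatKernelMeasure hh hR t x s₁) + δ := by
    calc ∫ y, φ y ∂(heatKernelMeasure hh hR t x s₁)
        ≤ ∫ y, (w y s₁ + δ) ∂(heatKernelMeasure hh hR t x s₁) :=
          integral_mono hiφ (hiw₁.add (integrable_const _)) fun y ↦ hφ2 y
      _ = ∫ y, w y s₁ ∂(heatKernelMeasure hh hR t x s₁) + δ := by
          rw [integral_add hiw₁ (integrable_const _), integral_const, probReal_univ, one_smul]
  linarith

/-- **Time-independent barrier sub-solutions**: if `u : M → ℝ` is continuous and `Δ_{h(r)} u ≥ -c`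
in the directional barrier sense at every `(y, r)`, `r ∈ (s₁, s₂]` (an `h(r)`-orthonormal frame,
lower barriers `Bᵢ(σ) ≤ u(exp_y(σ eᵢ))` touching at `0` with `Σᵢ bᵢ ≥ -c - η`, every `η > 0`),
then for the heat kernel measures of the family,
`∫ u dν_{x,t;s₂} ≤ ∫ u dν_{x,t;s₁} + c (s₂ − s₁)` for `s₁ < s₂ < t`
(`integral_heatKernelMeasure_le_of_directionalBarrier_family` with `w(y, r) = u(y)` and the
constant time barrier, `p = 0`). For the static family of a fixed metric this says that
`s ↦ ∫ u dν_{x,t;s} - c s` is nonincreasing, i.e. `τ ↦ (P_τ u)(x) + c τ` is nondecreasing.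
[cite: Bamler2020Entropy, §2.3] -/
theorem integral_heatKernelMeasure_le_of_directionalBarrier_static {m : ℕ} {H : Type*}
    [TopologicalSpace H] {I : ModelWithCorners ℝ (EuclideanSpace ℝ (Fin m)) H} [I.Boundaryless]
    {M : Type*} [TopologicalSpace M] [ChartedSpace H M] [IsManifold I ∞ M]
    [T2Space M] [CompactSpace M] [SecondCountableTopology M] [MeasurableSpace M] [BorelSpace M]
    [ConnectedSpace M]
    {h : ℝ → PseudoRiemannianMetric I ∞ (EuclideanSpace ℝ (Fin m)) (TangentSpace I : M → Type _)}
    [∀ r, (h r).HasLeviCivita]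
    (hh : IsContMDiffFamilyOn ∞ h univ) (hR : ∀ r, (h r).IsRiemannian) {t : ℝ}
    (x : M) {s₁ s₂ : ℝ} (h12 : s₁ < s₂) (hs₂t : s₂ < t) {u : M → ℝ} (huc : Continuous u) {c : ℝ}
    (hbar : ∀ y, ∀ r ∈ Ioc s₁ s₂, ∀ η > 0,
      ∃ (e : Fin (Module.finrank ℝ (EuclideanSpace ℝ (Fin m))) → TangentSpace I y)
        (B B' : Fin (Module.finrank ℝ (EuclideanSpace ℝ (Fin m))) → ℝ → ℝ)
        (b : Fin (Module.finrank ℝ (EuclideanSpace ℝ (Fin m))) → ℝ),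
        (∀ i j, (h r).val y (e i) (e j) = if i = j then 1 else 0) ∧
        (∀ i, (∀ᶠ σ in 𝓝 (0 : ℝ), HasDerivAt (B i) (B' i σ) σ) ∧ HasDerivAt (B' i) (b i) 0 ∧
          B i 0 = u y ∧
          ∀ᶠ σ in 𝓝 (0 : ℝ), B i σ ≤ u (expMap (h r).leviCivita y (σ • e i))) ∧
        -(∑ i, b i) ≤ c + η) :
    ∫ y, u y ∂(heatKernelMeasure hh hR t x s₂) ≤
      ∫ y, u y ∂(heatKernelMeasure hh hR t x s₁) + c * (s₂ - s₁) := by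
  have hwc : ContinuousOn (fun p : M × ℝ ↦ u p.1) (univ ×ˢ Icc s₁ s₂) :=
    (huc.comp continuous_fst).continuousOn
  refine integral_heatKernelMeasure_le_of_directionalBarrier_family hh hR x h12 hs₂t
    (w := fun y _ ↦ u y) hwc fun y r hr η hη ↦ ?_
  obtain ⟨e, B, B', b, hon, hB, hsum⟩ := hbar y r hr η hη
  refine ⟨e, B, B', b, fun _ ↦ u y, 0, hon, hB, ⟨(hasDerivAt_const r (u y)).hasDerivWithinAt,
    rfl, Eventually.of_forall fun _ ↦ le_rfl⟩, ?_⟩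
  simpa using hsum

end Literature.Geometry.Riemannian

end
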